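import Literature.NumberTheory.GaloisRepresentations.ContinuousShapiroLiftPairing
import HarnessLib

/-!
# The Shapiro lift ON CLASSES `Sh_N : H¹(N, X) → H¹(G, Maps(G ⧸ N, X))` and its compatibility with the RELATIVE
# corestriction: `H¹(Σ) ∘ Sh_{N'} = Sh_N ∘ cor_{N' → N}` (fibre sum = transfer), companion of
# `ContinuousShapiroLift.lean` / `ContinuousShapiroLiftPairing.lean`

Generic continuous group cohomology (no number theory); namespace `Literature.NumberTheory.GaloisRepresentations`.
Definitions with bodies and theorems; NO named fact, no `sorry`, no instance, no notation.

Let `G` be a topological group, `X : TopRep R G`, `N ≤ G` an open subgroup and `s` a system of representatives of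
`G ⧸ N` with `s(1·N) = 1`.  The tree's `shapiroCocycle X N hN hs f` (`ContinuousShapiroLift.lean`) lifts a continuous
crossed homomorphism `f` on `N` to one on `G` with values in `Maps(G ⧸ N, X)`, with `evalOne ∘ Sh = id` and Shapiro
injectivity (`oneCocycleClass_eq_zero_of_evalOne`).  This file passes to CLASSES:

* §1 `shapiroLift X N hN hs hs1 : H¹(N, X) →ₗ[R] H¹(G, Maps(G ⧸ N, X))` (`liftH1ₗ` of the class of the Shapiro
  cocycle; well defined by Shapiro injectivity), `shapiroLift_oneCocycleClass`, INDEPENDENCE of the representatives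
  (`shapiroLift_eq_of_reps`), and the two-sided inverse property with evaluation at the unit coset:
  **`shapiroLift [evalOne F] = [F]`** (`shapiroLift_oneCocycleClass_evalOne`) and injectivity (`shapiroLift_injective`)
  — i.e. `shapiroLift` IS the Shapiro isomorphism `H¹(N, X) ≅ H¹(G, Maps(G ⧸ N, X))` in degree one, explicitly
  (Neukirch–Schmidt–Wingberg (1.6.4); Serre VII §6);
* §2 the conjugation action: **`Sh_N (γ · c) = H¹(R_{γN}) (Sh_N c)`** (`shapiroLift_conjMap`, from the tree's
  `conjMap_evalOne_eq`: under Shapiro the action of `γ ∈ G` on `H¹(N, X)` is right translation by `γN`);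
* §3 restriction: **`H¹(∘π) (Sh_N c) = Sh_{N'} (res c)`** for `N' ≤ N` (`cohomologyMap_coindFinRes_shapiroLift`, from
  `cohomologyMap_coindFinRes_shapiroCocycle`);
* §4 THE RELATIVE FIBRE SUM: **`H¹(Σ) (Sh_{N'} c') = Sh_N (cor_{N' → N} c')`** (`cohomologyMap_coindFinSum_shapiroLift`)
  for the fibre sum `Σ = coindFinSum : Maps(G ⧸ N', X) → Maps(G ⧸ N, X)` and the tree's relative corestriction `coresLe`
  (explicit transfer).  Proof: for representatives of `G ⧸ N'` ADAPTED to representatives of `N ⧸ N'` (agreeing on the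
  fibre of `G ⧸ N' → G ⧸ N` over the unit coset), the evaluation at the unit coset of `Σ ∘ Sh_{N'}(f')` IS the transfer
  cocycle of `f'` from `N'` to `N` ON THE NOSE (`evalOne_coindFinSum_shapiroCocycle_adapted`: the fibre over `1·N` is
  the image of `N ⧸ N'`, and the Schreier elements match); the class statement follows by Shapiro injectivity and the
  independence of all choices.  This is the degree-one, relative form of «`cor = H(norm) ∘ sh⁻¹`» (Serre,
  *Cohomologie galoisienne* I §2.5; the tree's `cores_eq_cor` is the case `N = G`).

Why (consumer).  With `ContinuousShapiroLiftPairing.lean` (module projection formula `toLin_coindFinSum_left`, cup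
corollary `cupProduct_coindFinSum_left`) §4 gives the PROJECTION FORMULA (P1) of pairings built as
`inv(Sh_N x ∪_{⟨,⟩_N} Sh_N y)` across a tower `… ≤ U_{n+1} ≤ U_n ≤ … ≤ G`:
`Sh_n(cor x') ∪_n Sh_n y = H¹(Σ) Sh_{n+1} x' ∪_n Sh_n y = Sh_{n+1} x' ∪_{n+1} H¹(∘π) Sh_n y = Sh_{n+1} x' ∪_{n+1} Sh_{n+1}(res y)`
— the (D-layer) definition item of crux K3 `SignedKatoDivisibilityUpToAtTwo` (`Summits/BirchSwinnertonDyer`, line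
`colemanrat`), whose first argument moves by Kato's trace maps (`…LocalCoresCompat.lean`) and whose second (Kummer
classes of layer points, `SubgroupKummerClass.lean`) moves by restriction.

## References

* J. Neukirch, A. Schmidt, K. Wingberg, *Cohomology of Number Fields*, 2nd ed. (2008), I §5 (cor via coset
  representatives), I §6 Prop. (1.6.4) (Shapiro's lemma). [NeukirchSchmidtWingberg2008]
* J.-P. Serre, *Local Fields* (1979), VII §5–§6; *Galois Cohomology* (1997), I §2.5. [SerreLocalFields1979]
-/

noncomputable section

open CategoryTheory

open scoped Classical

universe u v

namespace Literature.NumberTheory.GaloisRepresentations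

open _root_.TopRep
open Literature.NumberTheory.EllipticCurves (schreierElt schreierElt_mem schreierElt_coe rep_mul_schreierElt
  subgroupInclusion subgroupInclusion_apply_coe subgroupConj subgroupConj_apply_coe)

variable {R : Type u} [CommRing R] [TopologicalSpace R]
variable {G : Type v} [Group G] [TopologicalSpace G] [IsTopologicalGroup G]

/-! ## §1 The Shapiro lift on classes -/

section Lift

variable (X : TopRep.{v} R G) (N : Subgroup G) (hN : IsOpen (N : Set G)) {s : G ⧸ N → G}
  (hs : ∀ x : G ⧸ N, (s x : G ⧸ N) = x)

/-- The Shapiro lift is additive in the cocycle. [cite: NeukirchSchmidtWingberg2008, I §6 Prop. (1.6.4)] -/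
theorem shapiroCocycle_add (f f' : contOneCocycles (subgroupRep X N)) :
    shapiroCocycle X N hN hs (f + f') = shapiroCocycle X N hN hs f + shapiroCocycle X N hN hs f' := by
  apply Subtype.ext
  ext g
  refine funext fun y => ?_
  change X.ρ (s y) ((f + f').1 _) = X.ρ (s y) (f.1 _) + X.ρ (s y) (f'.1 _)
  rw [Submodule.coe_add, ContinuousMap.add_apply, map_add]

/-- The Shapiro lift is `R`-homogeneous in the cocycle. [cite: NeukirchSchmidtWingberg2008, I §6 Prop. (1.6.4)] -/
theorem shapiroCocycle_smul (r : R) (f : contOneCocycles (subgroupRep X N)) :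
    shapiroCocycle X N hN hs (r • f) = r • shapiroCocycle X N hN hs f := by
  apply Subtype.ext
  ext g
  refine funext fun y => ?_
  change X.ρ (s y) ((r • f).1 _) = r • X.ρ (s y) (f.1 _)
  rw [Submodule.coe_smul, ContinuousMap.smul_apply, map_smul]

/-- The Shapiro lift of a principal crossed homomorphism is principal: `[f] = 0 ⟹ [Sh f] = 0` (its evaluation at the
unit coset is `f`, and evaluation is injective on classes). [cite: NeukirchSchmidtWingberg2008, I §6 Prop. (1.6.4)] -/
theorem oneCocycleClass_shapiroCocycle_eq_zero (hs1 : s ((1 : G) : G ⧸ N) = 1) (f : contOneCocycles (subgroupRep X N))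
    (hf : oneCocycleClass (subgroupRep X N) f = 0) :
    oneCocycleClass (coindFin X N) (shapiroCocycle X N hN hs f) = 0 :=
  oneCocycleClass_eq_zero_of_evalOne X N hs _ (by rw [evalOne_shapiroCocycle X N hN hs hs1 f, hf])

/-- The Shapiro lift `f ↦ Sh f` as an `R`-linear map on continuous crossed homomorphisms (the cocycle level of
`shapiroLift : H¹(N, X) →ₗ[R] H¹(G, Maps(G ⧸ N, X))`, `[f] ↦ [Sh f]`, which is well defined by
`oneCocycleClass_shapiroCocycle_eq_zero`, independent of the representatives by `shapiroLift_eq_of_reps`, and is the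
degree-one Shapiro isomorphism: `shapiroLift_oneCocycleClass_evalOne`, `shapiroLift_injective`).
[cite: NeukirchSchmidtWingberg2008, I §6 Prop. (1.6.4)] -/
def shapiroCocycleₗ : contOneCocycles (subgroupRep X N) →ₗ[R] contOneCocycles (coindFin.{u, v} X N) where
  toFun := shapiroCocycle X N hN hs
  map_add' := shapiroCocycle_add X N hN hs
  map_smul' := shapiroCocycle_smul X N hN hs

/-- `shapiroCocycleₗ` is `shapiroCocycle`. [cite: NeukirchSchmidtWingberg2008, I §6 Prop. (1.6.4)] -/
@[simp]
theorem shapiroCocycleₗ_apply (f : contOneCocycles (subgroupRep X N)) :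
    shapiroCocycleₗ X N hN hs f = shapiroCocycle X N hN hs f :=
  rfl

variable (hs1 : s ((1 : G) : G ⧸ N) = 1)

/-- **The Shapiro lift on classes** (see `shapiroCocycleₗ` for the cocycle level). [cite: NeukirchSchmidtWingberg2008, I §6 Prop. (1.6.4)]
[cite: SerreLocalFields1979, VII §6] -/
def shapiroLift : continuousCohomology 1 (subgroupRep X N) →ₗ[R] continuousCohomology 1 (coindFin.{u, v} X N) :=
  liftH1ₗ (subgroupRep X N) ((oneCocycleClassₗ (coindFin X N)).comp (shapiroCocycleₗ X N hN hs))
    fun f hf => by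
      rw [LinearMap.coe_comp, Function.comp_apply, shapiroCocycleₗ_apply, oneCocycleClassₗ_apply]
      exact oneCocycleClass_shapiroCocycle_eq_zero X N hN hs hs1 f hf

/-- `Sh_N [f] = [Sh f]`. [cite: NeukirchSchmidtWingberg2008, I §6 Prop. (1.6.4)] -/
@[simp]
theorem shapiroLift_oneCocycleClass (f : contOneCocycles (subgroupRep X N)) :
    shapiroLift X N hN hs hs1 (oneCocycleClass _ f) = oneCocycleClass (coindFin X N) (shapiroCocycle X N hN hs f) := by
  unfold shapiroLift
  rw [liftH1ₗ_oneCocycleClass]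
  rfl

/-- **`Sh_N [evalOne F] = [F]`** for every continuous crossed homomorphism `F : G → Maps(G ⧸ N, X)`: the lift on classes
is a LEFT inverse of evaluation at the unit coset, hence (with `evalOne ∘ Sh = id`) the Shapiro isomorphism in degree
one. [cite: NeukirchSchmidtWingberg2008, I §6 Prop. (1.6.4)] -/
theorem shapiroLift_oneCocycleClass_evalOne (F : contOneCocycles (coindFin X N)) :
    shapiroLift X N hN hs hs1 (oneCocycleClass _ (evalOne X N F)) = oneCocycleClass _ F := by
  rw [shapiroLift_oneCocycleClass, ← sub_eq_zero, ← oneCocycleClass_sub]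
  exact oneCocycleClass_eq_zero_of_evalOne X N hs _
    (by rw [evalOne_sub, evalOne_shapiroCocycle X N hN hs hs1, sub_self, oneCocycleClass_zero])

/-- `Sh_N` is onto: every class of `H¹(G, Maps(G ⧸ N, X))` is a Shapiro lift. [cite: NeukirchSchmidtWingberg2008, I §6 Prop. (1.6.4)] -/
theorem shapiroLift_surjective : Function.Surjective (shapiroLift X N hN hs hs1) := fun a => by
  obtain ⟨F, rfl⟩ := oneCocycleClass_surjective _ a
  exact ⟨oneCocycleClass _ (evalOne X N F), shapiroLift_oneCocycleClass_evalOne X N hN hs hs1 F⟩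

/-- `Sh_N` is injective (`evalOne ∘ Sh = id` on cocycles and principal lifts have principal evaluations).
[cite: NeukirchSchmidtWingberg2008, I §6 Prop. (1.6.4)] -/
theorem shapiroLift_injective : Function.Injective (shapiroLift X N hN hs hs1) := by
  rw [injective_iff_map_eq_zero]
  intro c hc
  obtain ⟨f, rfl⟩ := oneCocycleClass_surjective _ c
  rw [shapiroLift_oneCocycleClass] at hc
  have h := oneCocycleClass_evalOne_eq_zero X N _ hc
  rwa [evalOne_shapiroCocycle X N hN hs hs1] at h

/-- **Independence of the representatives**: two systems `s`, `s'` (both with `s(1·N) = 1`) define the same lift on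
classes. [cite: NeukirchSchmidtWingberg2008, I §6 Prop. (1.6.4)] -/
theorem shapiroLift_eq_of_reps {s' : G ⧸ N → G} (hs' : ∀ x : G ⧸ N, (s' x : G ⧸ N) = x)
    (hs'1 : s' ((1 : G) : G ⧸ N) = 1) : shapiroLift X N hN hs hs1 = shapiroLift X N hN hs' hs'1 := by
  apply LinearMap.ext
  intro c
  obtain ⟨f, rfl⟩ := oneCocycleClass_surjective _ c
  rw [shapiroLift_oneCocycleClass, shapiroLift_oneCocycleClass, ← sub_eq_zero, ← oneCocycleClass_sub]
  exact oneCocycleClass_eq_zero_of_evalOne X N hs _ (by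
    rw [evalOne_sub, evalOne_shapiroCocycle X N hN hs hs1, evalOne_shapiroCocycle X N hN hs' hs'1, sub_self,
      oneCocycleClass_zero])

omit [TopologicalSpace G] [IsTopologicalGroup G] in
/-- Representatives with `s(1·N) = 1` exist. [cite: NeukirchSchmidtWingberg2008, I §5] -/
theorem exists_reps_one : ∃ s : G ⧸ N → G, (∀ x : G ⧸ N, (s x : G ⧸ N) = x) ∧ s ((1 : G) : G ⧸ N) = 1 := by
  refine ⟨fun x => if x = ((1 : G) : G ⧸ N) then 1 else Quotient.out x, fun x => ?_, by simp⟩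
  show (((if x = ((1 : G) : G ⧸ N) then (1 : G) else Quotient.out x) : G) : G ⧸ N) = x
  split_ifs with hx
  · exact hx.symm
  · exact QuotientGroup.out_eq' x

end Lift

/-! ## §2 Conjugation = right translation -/

section Conj

variable (X : TopRep.{v} R G) (N : Subgroup G) [N.Normal] (hN : IsOpen (N : Set G)) {s : G ⧸ N → G}
  (hs : ∀ x : G ⧸ N, (s x : G ⧸ N) = x) (hs1 : s ((1 : G) : G ⧸ N) = 1)

omit [IsTopologicalGroup G] in
/-- Post-composition with an endomorphism (`postcomp`) is the pull-back along the identity of `G` (the cocycle-level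
form of `cohomologyMap`). [cite: NeukirchSchmidtWingberg2008, I §5] -/
theorem postcomp_eq_pullback {Y : TopRep.{v} R G} (η : Y ⟶ Y) (F : contOneCocycles Y) :
    postcomp η F = contOneCocycles.pullback (ContinuousMonoidHom.id G) (resIdHom η) F :=
  Subtype.ext (ContinuousMap.ext fun _ => rfl)

/-- **`Sh_N (γ · c) = H¹(R_{γN}) (Sh_N c)`**: the Shapiro lift carries the conjugation action of `γ ∈ G` on `H¹(N, X)`
(`conjMap`) to the right translation by `γN` on `Maps(G ⧸ N, X)` (`rTransHom`; tree `conjMap_evalOne_eq`).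
[cite: SerreLocalFields1979, VII §5] [cite: NeukirchSchmidtWingberg2008, I §6 Prop. (1.6.4)] -/
theorem shapiroLift_conjMap (γ : G) (c : continuousCohomology 1 (subgroupRep X N)) :
    shapiroLift X N hN hs hs1 (conjMap X N γ 1 c) = cohomologyMap (rTransHom X N (γ : G ⧸ N)) 1 (shapiroLift X N hN hs hs1 c) := by
  obtain ⟨f, rfl⟩ := oneCocycleClass_surjective _ c
  have hf : oneCocycleClass _ f = oneCocycleClass _ (evalOne X N (shapiroCocycle X N hN hs f)) := by
    rw [evalOne_shapiroCocycle X N hN hs hs1]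
  rw [shapiroLift_oneCocycleClass, hf, conjMap_evalOne_eq, shapiroLift_oneCocycleClass_evalOne,
    cohomologyMap_oneCocycleClass, postcomp_eq_pullback]

end Conj

/-! ## §3 Restriction = pull-back -/

section Res

variable (X : TopRep.{v} R G) {N N' : Subgroup G} (h : N' ≤ N) (hN : IsOpen (N : Set G)) (hN' : IsOpen (N' : Set G))
  {s : G ⧸ N → G} (hs : ∀ x : G ⧸ N, (s x : G ⧸ N) = x) (hs1 : s ((1 : G) : G ⧸ N) = 1)
  {s' : G ⧸ N' → G} (hs' : ∀ x : G ⧸ N', (s' x : G ⧸ N') = x) (hs'1 : s' ((1 : G) : G ⧸ N') = 1)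

/-- **`H¹(∘π) (Sh_N c) = Sh_{N'} (res_{N'}^{N} c)`**: the Shapiro lifts carry restriction to the pull-back along
`G ⧸ N' → G ⧸ N`. [cite: NeukirchSchmidtWingberg2008, I §6 Prop. (1.6.4)] -/
theorem cohomologyMap_coindFinRes_shapiroLift (c : continuousCohomology 1 (subgroupRep X N)) :
    cohomologyMap (coindFinRes X h) 1 (shapiroLift X N hN hs hs1 c) = shapiroLift X N' hN' hs' hs'1 (resLe X h 1 c) := by
  obtain ⟨f, rfl⟩ := oneCocycleClass_surjective _ c
  rw [shapiroLift_oneCocycleClass, cohomologyMap_coindFinRes_shapiroCocycle X h hN hN' hs hs1 hs' hs'1,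
    resLe_oneCocycleClass, shapiroLift_oneCocycleClass]

end Res

/-! ## §4 The relative fibre sum = the relative corestriction -/

section Cores

variable (X : TopRep.{v} R G) {N N' : Subgroup G} (h : N' ≤ N)

omit [TopologicalSpace G] [IsTopologicalGroup G] in
/-- The map `N ⧸ N' → G ⧸ N'`, `[m] ↦ [m]`, is injective, `N`-equivariant, and its image is the fibre of
`G ⧸ N' → G ⧸ N` over the unit coset. [cite: NeukirchSchmidtWingberg2008, I §5 (coset spaces)] -/
theorem quotientSubgroupOf_lift_spec :
    ∃ ιq : N ⧸ N'.subgroupOf N → G ⧸ N',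
      (∀ m : N, ιq (QuotientGroup.mk m) = QuotientGroup.mk (m : G)) ∧ Function.Injective ιq ∧
      (∀ (m : N) (x : N ⧸ N'.subgroupOf N), ιq (m • x) = (m : G) • ιq x) ∧
      (∀ z : G ⧸ N', Subgroup.quotientMapOfLE h z = ((1 : G) : G ⧸ N) ↔ ∃ x, ιq x = z) := by
  let ιq : N ⧸ N'.subgroupOf N → G ⧸ N' :=
    Quotient.map' (fun m : N => (m : G)) fun a b hab => by
      rw [QuotientGroup.leftRel_apply] at hab ⊢
      rw [Subgroup.mem_subgroupOf] at hab
      simpa using hab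
  have hmk : ∀ m : N, ιq (QuotientGroup.mk m) = QuotientGroup.mk (m : G) := fun m => rfl
  refine ⟨ιq, hmk, ?_, ?_, ?_⟩
  · intro y₁ y₂ hy
    induction y₁ using QuotientGroup.induction_on with
    | H m₁ =>
      induction y₂ using QuotientGroup.induction_on with
      | H m₂ =>
        rw [hmk, hmk, QuotientGroup.eq] at hy
        refine QuotientGroup.eq.mpr ?_
        rw [Subgroup.mem_subgroupOf]
        simpa using hy
  · intro m x
    induction x using QuotientGroup.induction_on with
    | H e => rw [MulAction.Quotient.smul_mk, hmk, hmk, MulAction.Quotient.smul_mk]; rfl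
  · intro z
    induction z using QuotientGroup.induction_on with
    | H g =>
      rw [Subgroup.quotientMapOfLE_apply_mk]
      constructor
      · intro hg
        have hgN : g ∈ N := by
          rw [QuotientGroup.eq, mul_one] at hg
          exact (Subgroup.inv_mem_iff N).mp hg
        exact ⟨QuotientGroup.mk ⟨g, hgN⟩, hmk _⟩
      · rintro ⟨x, hx⟩
        induction x using QuotientGroup.induction_on with
        | H m =>
          rw [hmk, QuotientGroup.eq] at hx
          have hmg : (m : G)⁻¹ * g ∈ N := h hx
          have hg : g ∈ N := by simpa using N.mul_mem m.2 hmg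
          rw [QuotientGroup.eq, mul_one]
          exact N.inv_mem hg


omit [TopologicalSpace G] [IsTopologicalGroup G] in
/-- **Adapted representatives.** Given representatives `sN` of `N ⧸ N'` (inside `N`) there is a system `s'` of
representatives of `G ⧸ N'` with `s'(1·N') = 1` that AGREES with `sN` on the fibre of `G ⧸ N' → G ⧸ N` over the unit
coset (`s' (ιq x) = sN x`). [cite: NeukirchSchmidtWingberg2008, I §5 (1.5.6)–(1.5.7)] -/
theorem exists_adapted_reps {sN : N ⧸ N'.subgroupOf N → N} (hsN : ∀ x, (sN x : N ⧸ N'.subgroupOf N) = x)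
    (hsN1 : sN ((1 : N) : N ⧸ N'.subgroupOf N) = 1) (ιq : N ⧸ N'.subgroupOf N → G ⧸ N')
    (hmk : ∀ m : N, ιq (QuotientGroup.mk m) = QuotientGroup.mk (m : G)) (hinj : Function.Injective ιq) :
    ∃ s' : G ⧸ N' → G, (∀ z : G ⧸ N', (s' z : G ⧸ N') = z) ∧ s' ((1 : G) : G ⧸ N') = 1 ∧
      ∀ x, s' (ιq x) = ((sN x : N) : G) := by
  have hmkN : ∀ x : N ⧸ N'.subgroupOf N, (QuotientGroup.mk ((sN x : N) : G) : G ⧸ N') = ιq x := fun x => by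
    rw [← hmk, hsN]
  refine ⟨fun z => if hz : ∃ x, ιq x = z then ((sN (Classical.choose hz) : N) : G) else Quotient.out z,
    fun z => ?_, ?_, fun x => ?_⟩
  · dsimp only
    by_cases hz : ∃ x, ιq x = z
    · rw [dif_pos hz, hmkN, Classical.choose_spec hz]
    · rw [dif_neg hz]; exact QuotientGroup.out_eq' z
  · dsimp only
    have h1 : ∃ x, ιq x = ((1 : G) : G ⧸ N') := ⟨QuotientGroup.mk 1, by rw [hmk]; rfl⟩
    rw [dif_pos h1]
    have hx : Classical.choose h1 = ((1 : N) : N ⧸ N'.subgroupOf N) :=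
      hinj (by rw [Classical.choose_spec h1, hmk]; rfl)
    rw [hx, hsN1]; rfl
  · dsimp only
    have hz : ∃ x', ιq x' = ιq x := ⟨x, rfl⟩
    rw [dif_pos hz, hinj (Classical.choose_spec hz)]

variable [Fintype (G ⧸ N')] [Fintype (N ⧸ N'.subgroupOf N)]

/-- **The evaluation at the unit coset of `Σ ∘ Sh_{N'}(f')` is the transfer of `f'` from `N'` to `N`, on the nose**, for
representatives of `G ⧸ N'` adapted to representatives `sN` of `N ⧸ N'`: the fibre of `G ⧸ N' → G ⧸ N` over `1·N` is the
image of `N ⧸ N'`, on it the Shapiro summands `s'(z) • f'(s'(z)⁻¹ u s'(u⁻¹z))` are the transfer summands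
`sN(u•x) • f'(sN(u•x)⁻¹ u sN(x))` (same Schreier elements). [cite: NeukirchSchmidtWingberg2008, I §5 (1.5.6)–(1.5.7), I §6 (1.6.4)] -/
theorem evalOne_coindFinSum_shapiroCocycle_adapted (hN' : IsOpen (N' : Set G))
    (hopen : IsOpen (((N'.subgroupOf N : Subgroup N)) : Set N))
    {sN : N ⧸ N'.subgroupOf N → N} (hsN : ∀ x, (sN x : N ⧸ N'.subgroupOf N) = x)
    {s' : G ⧸ N' → G} (hs' : ∀ z : G ⧸ N', (s' z : G ⧸ N') = z)
    (ιq : N ⧸ N'.subgroupOf N → G ⧸ N') (hinj : Function.Injective ιq)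
    (hsmul : ∀ (m : N) (x : N ⧸ N'.subgroupOf N), ιq (m • x) = (m : G) • ιq x)
    (hfib : ∀ z : G ⧸ N', Subgroup.quotientMapOfLE h z = ((1 : G) : G ⧸ N) ↔ ∃ x, ιq x = z)
    (hs'ι : ∀ x, s' (ιq x) = ((sN x : N) : G)) (f' : contOneCocycles (subgroupRep X N')) :
    evalOne X N (contOneCocycles.pullback (ContinuousMonoidHom.id G) (resIdHom (coindFinSum X h))
        (shapiroCocycle X N' hN' hs' f')) =
      transferCocycle (subgroupRep X N) (N'.subgroupOf N) hopen hsN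
        (contOneCocycles.pullback (subgroupOfHom h) (Y := subgroupRep (subgroupRep X N) (N'.subgroupOf N))
          (TopRep.ofHom ⟨ContinuousLinearMap.id R X, fun _ => rfl⟩) f') := by
  classical
  apply Subtype.ext
  ext u
  rw [evalOne_apply, pullback_id_resIdHom_apply, coindFinSum_apply, transferCocycle_apply, transferFun_apply,
    ← Finset.sum_filter]
  -- the fibre over the unit coset is the image of `ιq`
  have hfilter : (Finset.univ.filter fun z : G ⧸ N' => Subgroup.quotientMapOfLE h z = ((1 : G) : G ⧸ N)) =
      Finset.univ.image ιq := by
    ext z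
    simp only [Finset.mem_filter, Finset.mem_univ, true_and, Finset.mem_image, hfib]
  rw [hfilter, Finset.sum_image (fun x _ y _ hxy => hinj hxy),
    ← Equiv.sum_comp (MulAction.toPerm (u : N)) ]
  refine Finset.sum_congr rfl fun x _ => ?_
  rw [MulAction.toPerm_apply, shapiroCocycle_apply, hsmul, inv_smul_smul, ← hsmul, hs'ι, subgroupRep_ρ_apply]
  congr 1
  rw [contOneCocycles.pullback_apply, TopRep.hom_ofHom]
  change f'.1 _ = f'.1 _
  congr 1
  apply Subtype.ext
  change ((schreierElt N' hs' ((u : N) : G) (ιq x) : N') : G) =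
    (((schreierElt (N'.subgroupOf N) hsN u x : N'.subgroupOf N) : N) : G)
  rw [schreierElt_coe, schreierElt_coe]
  push_cast
  rw [← hsmul, hs'ι, hs'ι]

/-- **`H¹(Σ) (Sh_{N'} c') = Sh_N (cor_{N' → N} c')`** — the Shapiro lifts carry the RELATIVE corestriction (the tree's
`coresLe`, explicit transfer) to the fibre sum `coindFinSum : Maps(G ⧸ N', X) → Maps(G ⧸ N, X)`.  All representatives
arbitrary (with `s(1) = 1`): the classes do not depend on them (`shapiroLift_eq_of_reps`, `coresWith_eq_cores`); the proof
runs with adapted ones (`evalOne_coindFinSum_shapiroCocycle_adapted`) and Shapiro injectivity.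
[cite: NeukirchSchmidtWingberg2008, I §5 (1.5.6)–(1.5.7), I §6 Prop. (1.6.4)] [cite: SerreLocalFields1979, VII §6] -/
theorem cohomologyMap_coindFinSum_shapiroLift (hN : IsOpen (N : Set G)) (hN' : IsOpen (N' : Set G))
    {s : G ⧸ N → G} (hs : ∀ x : G ⧸ N, (s x : G ⧸ N) = x) (hs1 : s ((1 : G) : G ⧸ N) = 1)
    {s' : G ⧸ N' → G} (hs' : ∀ x : G ⧸ N', (s' x : G ⧸ N') = x) (hs'1 : s' ((1 : G) : G ⧸ N') = 1)
    (c' : continuousCohomology 1 (subgroupRep X N')) :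
    cohomologyMap (coindFinSum X h) 1 (shapiroLift X N' hN' hs' hs'1 c') =
      shapiroLift X N hN hs hs1 (coresLe X h hN' c') := by
  classical
  -- the comparison map `N ⧸ N' → G ⧸ N'`, representatives of `N ⧸ N'` with `sN(1) = 1`, adapted representatives of `G ⧸ N'`
  obtain ⟨ιq, hmk, hinj, hsmul, hfib⟩ := quotientSubgroupOf_lift_spec (G := G) h
  obtain ⟨sN, hsN, hsN1⟩ := exists_reps_one (G := N) (N'.subgroupOf N)
  obtain ⟨t, ht, ht1, htι⟩ := exists_adapted_reps hsN hsN1 ιq hmk hinj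
  rw [shapiroLift_eq_of_reps X N' hN' hs' hs'1 ht ht1]
  obtain ⟨f', rfl⟩ := oneCocycleClass_surjective _ c'
  rw [shapiroLift_oneCocycleClass, cohomologyMap_oneCocycleClass, coresLe_oneCocycleClass X h hN' hsN,
    shapiroLift_oneCocycleClass, ← sub_eq_zero, ← oneCocycleClass_sub]
  refine oneCocycleClass_eq_zero_of_evalOne X N hs _ ?_
  rw [evalOne_sub, evalOne_coindFinSum_shapiroCocycle_adapted X h hN' (isOpen_subgroupOf N hN') hsN ht ιq hinj hsmul
    hfib htι f', evalOne_shapiroCocycle X N hN hs hs1, sub_self, oneCocycleClass_zero]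

end Cores

end Literature.NumberTheory.GaloisRepresentations

end
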